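import Summits.HodgeConjecture.HodgeConjecture.Theorems.R90S6IntegralHilbertNinetyGLInt   -- ★ W9-f `exists_mem_glInt_mul_map_eq` (integral Hilbert 90 for `GL_N(𝒪)`, R90-C14-p08, ★ p863450)
import Summits.HodgeConjecture.HodgeConjecture.Theorems.R90S6GLCosetLatticeDict          -- ★ W7-f (i) `latt_eq_latt_iff_mem_glInt` (lattice wording of the fixed coset); brings `glInt`, `latt`, the `Valued`∕`ValuativeRel` bridge
import HarnessLib

/-!
# R90 · S6 «Ch. 14.1–14.5 stable TF» — WAVE 9 card W9-g: «FIXED COSETS DESCEND» — a `σ`-stable coset `g·GL_N(𝒪)` of `GL_N(E_w)` contains a `σ`-fixed representative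
# (`(X_E)^σ = X`, Kottwitz's condition (b) for `K_E = GL_N(𝒪_{E_w})`) (`Theorems/R90S6FixedCosetsDescend.lean`)

Cell `hodgecm-mathlib`, crux H413 (`stmt-HodgeConjecture-24833`), route `HCCMUnconditional`; programme R90-TF, section S6 (base `R90-C14`, dealer R90-C14-plan (g2)), seat
R90-C14-p10 (g0); card **W9-g** of typ2's W9 TARGET SHEET `R90/R90-C14-typ2/g2/S6_wave9_targets.v1.lean` fcf093c820d92b07 (= v1.1 51eba5d71d8cbf67) :160–:163, DAG r5 row E1.4.3.2.2
«INTEGRAL HILBERT 90, UNRAMIFIED — fixed cosets descend» (DEAL 2026-09-05T00:00:17Z l.5729).  Statement VERBATIM from the sheet (namespace `…R90.S6`, `.Wave9` dropped).  Lane `--kind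
proof --supports stmt-HodgeConjecture-24833` (helper; ONE public theorem + one bookkeeping lemma; no definition, no instance, no notation, no named fact, no `sorry`).  Imports: ★ W9-f
`Theorems.R90S6IntegralHilbertNinetyGLInt` (R90-C14-p08, integral Hilbert 90 for `GL_N(𝒪)`) + ★ W7-f (i) `Theorems.R90S6GLCosetLatticeDict` + HarnessLib; no `Cruxes` import.

THE MATHEMATICS (Kottwitz 1986 §1 p. 240; Serre, *Local Fields* X §1 Prop. 3).  `K = E_w` a valued field with an involution `σ` (the conjugation of the unramified quadratic `E_w ∕ F_v`,
residually non-trivial: `hres`), acting entrywise on `GL_N(K)` (`Matrix.GeneralLinearGroup.map σ`); `GL_N(𝒪) = glInt N K`.  If the coset `g·GL_N(𝒪)` is `σ`-STABLE — `g⁻¹σ(g) ∈ GL_N(𝒪)`,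
i.e. `σ(g)·𝒪^N = g·𝒪^N` (★ W7-f (i) `latt_eq_latt_iff_mem_glInt`) — then `c := g⁻¹σ(g) ∈ GL_N(𝒪)` is a COCYCLE (`c·σ(c) = g⁻¹σ(g)σ(g)⁻¹σσ(g) = 1` as `σσ = id`), so by the INTEGRAL
HILBERT 90 (★ W9-f `exists_mem_glInt_mul_map_eq`: `c·σ(a) = a` for some `a ∈ GL_N(𝒪)`) the representative `g₀ := g·a` of the same coset is `σ`-FIXED: `σ(g₀) = σ(g)σ(a) = g·c·σ(a) = g·a`.
Hence «the fixed point set of `σ` on `X_E = GL_N(E_w) ∕ K_E` is `X = GL_N(F_v) ∕ K`» (Kottwitz's (b) ⇒ p. 240), the descent step of the [Kt₁] road J (E1.4.3.3.2).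
* `map_map_eq_self_of_involutive`: `σ(σ(g)) = g` on `GL_N(K)` for an involution `σ`;
* **`exists_map_eq_self_of_inv_mul_map_mem_glInt`** (W9-g): `g⁻¹σ(g) ∈ GL_N(𝒪) ⟹ ∃ g₀, σ(g₀) = g₀ ∧ g⁻¹g₀ ∈ GL_N(𝒪)`;
* `exists_map_eq_self_latt_eq_of_latt_map_eq` (lattice wording): `σ(g)·𝒪^N = g·𝒪^N ⟹ ∃ g₀, σ(g₀) = g₀ ∧ g₀·𝒪^N = g·𝒪^N`.
HONEST LABEL: a five-line corollary of ★ W9-f; proves no printed global statement, discharges no citation; count-neutral helper until E1.4.3.3.2 consumes it.  HC_CM is proved only modulo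
the 7 printed citations (2 remaining named inputs: hLiu418 = stmt-HodgeConjecture-24832, h413 = stmt-HodgeConjecture-24833) until rung 0 closes.

## References
* [Kottwitz1986BaseChangeUnits] R. Kottwitz, *Base change for unit elements of Hecke algebras*, Compositio Math. 60 (1986), §1 p. 240 («Condition (b) … implies that the fixed point set of
  `σ` on `X_L` is equal to `X`»).
* [Serre1979] J.-P. Serre, *Local Fields*, GTM 67 (1979), Ch. X §1 Prop. 3 (Hilbert 90 for `GL_n`).
-/
set_option autoImplicit false
-- the mandated namespace repeats the single-problem summit's segment (`HodgeConjecture.HodgeConjecture`)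
set_option linter.dupNamespace false

noncomputable section

open scoped Valued WithZero Matrix MatrixGroups
open Literature.NumberTheory.Automorphic Literature.NumberTheory.Automorphic.HermitianLattice Literature.NumberTheory.Automorphic.UnitaryLatticeTree

namespace Summit.HodgeConjecture.HodgeConjecture.R90.S6

variable {K : Type*} [Field K] [Valued K ℤᵐ⁰] {σ : K →+* K} {N : ℕ}

omit [Valued K ℤᵐ⁰] in
/-- For an involution `σ` of `K` (applied entrywise), `σ(σ(g)) = g` on `GL_N(K)`. [cite: Serre1979, Ch. X §1] -/
theorem map_map_eq_self_of_involutive (hσσ : ∀ a, σ (σ a) = a) (g : GL (Fin N) K) :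
    Matrix.GeneralLinearGroup.map σ (Matrix.GeneralLinearGroup.map σ g) = g := by
  refine Matrix.GeneralLinearGroup.ext fun i j => ?_
  change σ (σ ((g : Matrix (Fin N) (Fin N) K) i j)) = (g : Matrix (Fin N) (Fin N) K) i j
  exact hσσ _

section Descent

variable [ValuativeRel K] [(Valued.v : Valuation K ℤᵐ⁰).Compatible]

/-- **W9-g — «FIXED COSETS DESCEND»** (Kottwitz's condition (b) for `K_E = GL_N(𝒪_{E_w})`, `Γ = Gal(E_w ∕ F_v) = ⟨σ⟩`): if the coset `g·GL_N(𝒪)` is `σ`-stable — `g⁻¹σ(g) ∈ GL_N(𝒪)` —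
then it contains a `σ`-FIXED representative `g₀ = σ(g₀)` with `g⁻¹g₀ ∈ GL_N(𝒪)`: apply ★ W9-f (integral Hilbert 90, `exists_mem_glInt_mul_map_eq`) to the cocycle `c = g⁻¹σ(g)` (`c σ(c) = 1` by `hσσ`)
and put `g₀ = g a`.  Hence `(X_E)^σ = X`. [cite: Kottwitz1986BaseChangeUnits, §1 p. 240] [cite: Serre1979, Ch. X §1 Prop. 3] -/
theorem exists_map_eq_self_of_inv_mul_map_mem_glInt (hσσ : ∀ a, σ (σ a) = a) (hvσ : ∀ a, Valued.v (σ a) = Valued.v a)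
    (hres : ∃ r : K, Valued.v r ≤ 1 ∧ Valued.v (σ r - r) = 1)
    (g : GL (Fin N) K) (hg : g⁻¹ * Matrix.GeneralLinearGroup.map σ g ∈ glInt N K) :
    ∃ g₀ : GL (Fin N) K, Matrix.GeneralLinearGroup.map σ g₀ = g₀ ∧ g⁻¹ * g₀ ∈ glInt N K := by
  -- the cocycle `c = g⁻¹ σ(g)`
  have hcc : (g⁻¹ * Matrix.GeneralLinearGroup.map σ g) * Matrix.GeneralLinearGroup.map σ (g⁻¹ * Matrix.GeneralLinearGroup.map σ g) = 1 := by
    rw [map_mul, map_inv, map_map_eq_self_of_involutive hσσ]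
    group
  obtain ⟨a, ha, hca⟩ := exists_mem_glInt_mul_map_eq hσσ hvσ hres _ hg hcc
  refine ⟨g * a, ?_, by rwa [inv_mul_cancel_left]⟩
  rw [map_mul]
  calc Matrix.GeneralLinearGroup.map σ g * Matrix.GeneralLinearGroup.map σ a
      = g * (g⁻¹ * Matrix.GeneralLinearGroup.map σ g * Matrix.GeneralLinearGroup.map σ a) := by group
    _ = g * a := by rw [hca]

/-- **W9-g in lattice words**: if `σ(g)·𝒪^N = g·𝒪^N` then some `σ`-fixed `g₀` frames the same lattice, `g₀·𝒪^N = g·𝒪^N` (★ W7-f (i) `latt_eq_latt_iff_mem_glInt` on both sides of W9-g) — the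
`σ`-stable vertices of `X_E` are exactly the images of the vertices of `X`. [cite: Kottwitz1986BaseChangeUnits, §1 p. 240] -/
theorem exists_map_eq_self_latt_eq_of_latt_map_eq (hσσ : ∀ a, σ (σ a) = a) (hvσ : ∀ a, Valued.v (σ a) = Valued.v a)
    (hres : ∃ r : K, Valued.v r ≤ 1 ∧ Valued.v (σ r - r) = 1)
    (g : GL (Fin N) K)
    (hg : latt ((Matrix.GeneralLinearGroup.map σ g : GL (Fin N) K) : Matrix (Fin N) (Fin N) K) = latt ((g : GL (Fin N) K) : Matrix (Fin N) (Fin N) K)) :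
    ∃ g₀ : GL (Fin N) K, Matrix.GeneralLinearGroup.map σ g₀ = g₀ ∧
      latt ((g₀ : GL (Fin N) K) : Matrix (Fin N) (Fin N) K) = latt ((g : GL (Fin N) K) : Matrix (Fin N) (Fin N) K) := by
  rw [eq_comm, latt_eq_latt_iff_mem_glInt] at hg
  obtain ⟨g₀, hg₀, hmem⟩ := exists_map_eq_self_of_inv_mul_map_mem_glInt hσσ hvσ hres g hg
  exact ⟨g₀, hg₀, by rw [eq_comm, latt_eq_latt_iff_mem_glInt]; exact hmem⟩

end Descent

end Summit.HodgeConjecture.HodgeConjecture.R90.S6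

end
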